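import Summits.CriticalPhenomena.Ising3DConformalLimit.Theorems.EnergyNotSigmaSquaredGapForcesFarMergingScreeningDefsUnpin
import Summits.CriticalPhenomena.Ising3DConformalLimit.Theorems.EnergyNotSigmaSquaredGapForcesFarMergingScreeningReduction

/-!
# The reshaped far end of line `screening-form-lemma-a1`: glue
(crux `GapForcesFarMerging`, item stmt-CriticalPhenomena-4468, route `EnergyNotSigmaSquared`; lead seat c2
`prover-line-stmt-CriticalPhenomena-4468-c2-0`; helper file of the registered stub
`stub_farScreening : HittingLowerBound → RootOpacityIO → FarScreeningIO`)

The registered theorem `farScreening_of_unpin : HazardRelocation → Unpin → RootOpacityIO → FarScreeningIO` composes the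
two currencies of `Theorems/EnergyNotSigmaSquaredGapForcesFarMergingScreeningDefsUnpin.lean` into the far-screening
transfer: `RootOpacityIO` supplies infinitely many windowed opaque octaves `k` (some far scale `m ≥ 2^{k+3}`, frequently in
the box size `n`); `HazardRelocation` moves the far ends down to `2^{k+3}`; `Unpin` produces, for some `u` in a finite family
`F`, a screening drop `≥ c'` of the fresh probe from `2^{k-j}·u`; a pigeonhole over `F` (finitely many `u`, infinitely many
`k`) pins ONE injective shape `unpinShape 2^{j+3} u = (0, up 2^{j+3}, u, dn 2^{j+3})` along the dilations `L = 2^{k-j}`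
(`L • up 2^{j+3} = up 2^{k+3}`, `zsmul_unpinShape`). Pure filter bookkeeping; no lattice input. With it the crux reads
`Floors ∧ HazardRelocation ∧ Unpin ⟹ GapForcesFarMerging` (`gapForcesFarMerging_of_floors_hazardRelocation_unpin`, from the
landed certificate `gapForcesFarMerging_of_floors_farScreening`, p100284).
-/

noncomputable section

namespace Summit.CriticalPhenomena.Ising3DConformalLimit.GapForcesFarMergingScreening

open scoped symmDiff ENNReal
open MeasureTheory Filter Finset
open Literature.Probability.LatticeModels Literature.Probability.Percolation
open Summit.CriticalPhenomena.Ising3DConformalLimit.Theorems.GapForcesFarMerging.Negative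
  (e₁ e₂ cc2 xR up dn FarMergingShape SinglePinchLawShape)

/-- Frequently-often an existential over a finite set ⇒ some member occurs frequently often. [folklore] -/
theorem frequently_exists_mem_finset {ι : Type*} {s : Finset ι} {l : Filter ℕ} {P : ι → ℕ → Prop}
    (h : ∃ᶠ n in l, ∃ i ∈ s, P i n) : ∃ i ∈ s, ∃ᶠ n in l, P i n := by
  by_contra hcon
  push Not at hcon
  have hall : ∀ᶠ n in l, ∀ i ∈ s, ¬P i n :=
    (Filter.eventually_all_finset s).2 fun i hi => hcon i hi
  obtain ⟨n, ⟨i, hi, hP⟩, hn⟩ := (h.and_eventually hall).exists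
  exact hn i hi hP

/-- **THE RESHAPED FAR END (registered glue)**: hazard relocation + un-pinning at a bounded-aspect opaque windowed
octave turn root opacity into far screening of a fixed dilated shape. [folklore] -/
theorem farScreening_of_unpin : HazardRelocation → Unpin → RootOpacityIO → FarScreeningIO := by
  intro hH hU hRO
  obtain ⟨c, θ, hc, hθ, hfreq⟩ := hRO
  obtain ⟨c', hc', hH'⟩ := hH c hc
  obtain ⟨c'', hc'', j, F, hinj, hU'⟩ := hU c' θ hc' hθ
  -- at every opaque windowed octave some `u ∈ F` is screened, frequently in `n`
  have hk : ∃ᶠ k : ℕ in atTop, ∃ u ∈ F, ∃ᶠ n : ℕ in atTop,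
      meanScreening n n 0 (up (2 ^ (k + 3))) ((((2 ^ (k - j) : ℕ) : ℤ)) • u) (dn (2 ^ (k + 3))) ≤ 1 - c'' := by
    refine (hfreq.and_eventually (hH'.and hU')).mono ?_
    rintro k ⟨⟨hwin, m, hm, hfrn⟩, hHk, hUk⟩
    refine frequently_exists_mem_finset ?_
    refine (hfrn.and_eventually ((hHk m hm).and (hUk hwin))).mono ?_
    rintro n ⟨hop, hHn, hUn⟩
    exact hUn (hHn hop)
  -- pigeonhole over the finite family: one `u` serves infinitely many octaves
  obtain ⟨u, huF, hku⟩ := frequently_exists_mem_finset hk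
  refine ⟨c'', hc'', unpinShape (2 ^ (j + 3)) u, hinj u huF, fun L₀ => ?_⟩
  obtain ⟨k, hk0, hkn⟩ := (Filter.frequently_atTop.1 hku) (j + L₀)
  refine ⟨2 ^ (k - j), ?_, ?_⟩
  · calc L₀ ≤ k - j := by omega
      _ ≤ 2 ^ (k - j) := Nat.lt_two_pow_self.le
  · obtain ⟨h0, h1, h2, h3⟩ := zsmul_unpinShape (2 ^ (j + 3)) (2 ^ (k - j)) u
    have hpow : 2 ^ (j + 3) * 2 ^ (k - j) = 2 ^ (k + 3) := by
      rw [← pow_add]; congr 1; omega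
    rw [h0, h1, h2, h3, hpow]
    exact hkn


/-- **The crux modulo the three open stubs of the reshaped line** (`Floors`, `HazardRelocation`, `Unpin`): the landed
certificate `gapForcesFarMerging_of_floors_farScreening` (p100284) with the far-screening transfer supplied by the glue. [folklore] -/
theorem gapForcesFarMerging_of_floors_hazardRelocation_unpin :
    Floors → HazardRelocation → Unpin →
      Summit.CriticalPhenomena.Ising3DConformalLimit.Theses.EnergyNotSigmaSquared.GapForcesFarMerging :=
  fun hF hH hU =>
    EnergyNotSigmaSquaredGapForcesFarMerging.gapForcesFarMerging_of_floors_farScreening hF (farScreening_of_unpin hH hU)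

end Summit.CriticalPhenomena.Ising3DConformalLimit.GapForcesFarMergingScreening

end
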